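import Mathlib.Analysis.SpecialFunctions.Pow.Real
import Mathlib.Analysis.SpecialFunctions.Log.Basic
import Mathlib.MeasureTheory.Integral.Lebesgue.Basic
import Mathlib.MeasureTheory.Integral.Lebesgue.Markov
import Mathlib.Analysis.PSeries
import Mathlib.Analysis.SpecificLimits.Basic
import Literature.MathematicalPhysics.KineticTheory.InfiniteChainDynamics
import HarnessLib

/-!
# The Buttà–Marchioro dynamics of the infinite anharmonic chain on its superstable set

Topic `Literature/MathematicalPhysics/KineticTheory` (sibling of `InfiniteChainDynamics`). Named
facts from P. Buttà, C. Marchioro, *Dynamics of infinite classical anharmonic crystals*, J. Stat.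
Phys. 164 (2016) 680–692 (arXiv:1602.01294), §2, specialised to the tree's setting `d = 1`
(lattice `ℤ`), `ν = 1` (scalar oscillators), nearest-neighbour chain `P : OscillatorChain`
(pinning `U = P.U`, coupling `V = P.V`; equations of motion `OscillatorChain.IsSolution`, LLL
(1a)–(1c), which for EVEN `V` coincide with BM's (2.1)–(2.2),
`F_i = -U'(q_i) - ∑_{|j-i|=1} V'(q_i - q_j)`).

Why this file exists (grounding of `Summit.AtomisticToContinuum.FouriersLaw.Theses.CurrentTiltQuench.SymmetricSetup`,
`…Theses.FourierGreenKubo.InfiniteVolumeSetup`, `…Theses.NoHiddenCharges.GibbsHydroStructure` and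
the other "symmetric set-up / good dynamics" de-vacuifiers of the Fourier's-law routes): the
module docstring of `InfiniteChainDynamics` records that for the pinned chain with QUARTIC
coupling (`U = ω₂q²/2 + lam q⁴/4`, `V = r²/2 + β r⁴/4`, `β > 0`) only the weak a.e.-existence
theorem LLL 1977 Thm 3 is vendored — no uniqueness, no invariant carrier, hence no
`InfiniteChainDynamics` object. Buttà–Marchioro 2016, Thm 2.1 supplies exactly that for ALL even
non-negative polynomial `U`, `V` in `d = 1`: a one-parameter GROUP `Φ_t` on the explicit set
`𝒳₀ = {Q < ∞}` (`bmGood`), solving the equations, unique there, with a quantitative bound on the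
growth of `Q(Φ_t x)`; and `𝒳₀` has full measure for every state obeying the superstability
estimate (2.3) (BM (2.6), after Buttà–Caglioti–Di Ruzza–Marchioro 2007, Appendix).

## Contents

* `OscillatorChain.bmLocalEnergy P μ k σ` — BM's `W_{μ,k}` (2.4) for `d = 1`:
  `∑_{i ∈ Λ_{μ,k}} (p_i²/2 + U(q_i) + 1) + ∑_{i,j ∈ Λ_{μ,k}, |j-i| = 1} V(q_i - q_j)`,
  `Λ_{μ,k} = {μ-k, …, μ+k}` (ORDERED pairs, as printed: each bond is counted twice).
* `OscillatorChain.bmGrowthSet / bmGrowth / bmGood` — the set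
  `{W_{μ,k}(σ)/(2k+1) : μ ∈ ℤ, k ∈ ℕ, k > log(e + |μ|)}`, its supremum `Q(σ)` (2.5) and
  `𝒳₀ = {σ : Q(σ) < ∞}` (encoded junk-free as "the set is bounded above").
* `OscillatorChain.IsEvenPolyOfDegree f s` — "`f` is an even non-negative polynomial of degree `2s`
  with positive leading coefficient": `f(x) = ∑_{m ≤ s} a_m x^{2m}`, `a_s > 0`, `f ≥ 0` (the
  standing hypothesis of BM §1–§2 on `U` and `V`, read conservatively as a polynomial in `ξ²`).
* `OscillatorChain.HasSuperstabilityEstimate P ω` — BM (2.3): `ω` a probability measure with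
  `ω(e^{λ W_{μ,k}}) ≤ e^{C_ω (2k+1)}` for all `μ`, `k` and all small `λ > 0` (as a `lintegral`,
  so no Bochner junk).
* FACTS (statements only, `Prop`s, to be taken as hypotheses `(h : …)`):
  `ButtaMarchioro2016_thm21_chain` (Thm 2.1, `d = ν = 1`) and `ButtaMarchioro2016_eq26_chain`
  ((2.6): exponential tail of `Q` and `ω(𝒳₀) = 1` under (2.3)).
* PROVED: `ButtaMarchioro2016_eq26_chain_holds` discharges the fact `ButtaMarchioro2016_eq26_chain`
  (exponential Chebyshev inequality + union bound over the boxes `Λ_{μ,k}`, the argument of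
  Buttà–Caglioti–Di Ruzza–Marchioro 2007, Appendix, to which BM refer), with the helper lemmas
  `measurable_bmLocalEnergy`, `measure_bmLocalEnergy_gt_le`, `measure_bmGrowthSet_gt_le`.
* PROVED API: `ButtaMarchioro2016_thm21_chain.exists_dynamics` packages Thm 2.1 as an
  `InfiniteChainDynamics P` with carrier `𝒳₀` (+ group law + growth bound);
  `pinnedChain_isEvenPolyOfDegree_U/_V`: the tree's `pinnedChain ω₂ lam β γ` (`ω₂ ≥ 0`,
  `lam > 0`, `β > 0`) satisfies the hypotheses with `σ₁ = σ₂ = 2` — the case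
  `σ₁ = 2 < 2σ₂ - 1 = 3` NOT covered by LLL Thm 1 / BCDM 2007, covered by BM 2016.

## Reading of the printed uniqueness clause (flagged for reviewers)

Thm 2.1 prints: "there is a one-parameter group of transformations `Φ_t : 𝒳₀ → 𝒳₀`, `t ∈ ℝ`,
such that `t → Φ_t(x)` is the unique global solution to Eq. (2.1) with initial condition
`Φ_0(x) = x`." No separate uniqueness class is printed; unqualified uniqueness among ALL global
solutions is false (the paper's own Tikhonov-type example, §1), so the clause is read here in the
only way the statement allows: uniqueness among global solutions WITH VALUES IN `𝒳₀`
(`∀ t, γ t ∈ 𝒳₀`). This is exactly the `unique` field of the tree's `InfiniteChainDynamics`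
with `carrier = 𝒳₀`. The proof (§3, after Dobrushin–Fritz) is not reproduced.

## NOT here

* The superstability estimate (2.3) FOR GIBBS STATES of the chain (Benfatto–Marchioro–Presutti–
  Pulvirenti 1980, cited by BM as [BMPP]; Ruelle 1976) — not held, not vendored; a user of
  `ButtaMarchioro2016_eq26_chain` must supply `HasSuperstabilityEstimate P μ`.
* Invariance of a Gibbs state under `Φ_t` (BM and BCDM ASSUME time-invariant states; the route to
  it is finite-volume invariance `measurePreserving_severedFlow_of_isChainGibbsMeasure` + the
  partial-dynamics limit (3.3)) — not printed as a theorem, not vendored.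
* Thm 2.2 (almost-linear light cone for `{f_i, Φ_t g_j}`), `d ≥ 2`, `ν ≥ 2`.
-/

noncomputable section

open MeasureTheory Filter Set
open scoped Topology BigOperators ENNReal

namespace Literature.MathematicalPhysics.KineticTheory.HeatConduction

namespace OscillatorChain

variable (P : OscillatorChain)

/-! ### BM's local energy, growth functional and good set (d = 1) -/

/-- Buttà–Marchioro's local energy of the box `Λ_{μ,k} = {μ-k, …, μ+k}`:
`W_{μ,k}(σ) = ∑_{i ∈ Λ_{μ,k}} (p_i²/2 + U(q_i) + 1) + ∑_{i, j ∈ Λ_{μ,k}, |j-i|=1} V(q_i - q_j)`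
(the pair sum runs over ORDERED pairs, as printed). [cite: ButtaMarchioro2016, §2 eq. (2.4)] -/
def bmLocalEnergy (μ : ℤ) (k : ℕ) (σ : ChainConfig) : ℝ :=
  (∑ i ∈ Finset.Icc (μ - k) (μ + k), ((σ i).2 ^ 2 / 2 + P.U (σ i).1 + 1)) +
    ∑ i ∈ Finset.Icc (μ - k) (μ + k), ∑ j ∈ Finset.Icc (μ - k) (μ + k),
      if |j - i| = 1 then P.V ((σ i).1 - (σ j).1) else 0

/-- The set of normalised local energies entering BM's `Q` (2.5) for `d = 1`:
`{W_{μ,k}(σ)/(2k+1) : μ ∈ ℤ, k ∈ ℕ, k > log(e + |μ|)}`. [cite: ButtaMarchioro2016, §2 eq. (2.5)] -/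
def bmGrowthSet (σ : ChainConfig) : Set ℝ :=
  {r | ∃ (μ : ℤ) (k : ℕ), Real.log (Real.exp 1 + |(μ : ℝ)|) < (k : ℝ) ∧
    r = P.bmLocalEnergy μ k σ / (2 * (k : ℝ) + 1)}

/-- BM's growth functional `Q(σ) = sup_{μ ∈ ℤ} sup_{k > log(e+|μ|)} W_{μ,k}(σ)/(2k+1)` (2.5), `d = 1`,
as a real supremum (`sSup`; meaningful on `bmGood = {Q < ∞}`, Mathlib junk value off it — every
use below is restricted to `bmGood`). [cite: ButtaMarchioro2016, §2 eq. (2.5)] -/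
def bmGrowth (σ : ChainConfig) : ℝ :=
  sSup (P.bmGrowthSet σ)

/-- BM's set of good initial data `𝒳₀ = {x ∈ 𝒳 : Q(x) < ∞}` (after (2.5)), `d = 1`, encoded as
"the set of normalised local energies is bounded above". [cite: ButtaMarchioro2016, §2 after eq. (2.5)] -/
def bmGood : Set ChainConfig :=
  {σ | BddAbove (P.bmGrowthSet σ)}

/-- "`f` is an even non-negative polynomial of degree `2s` (hence with positive leading
coefficient)" — BM's standing hypothesis on `U` (`s = σ₁`) and `V` (`s = σ₂`), §1–§2, read as a
polynomial in `ξ²`: `f(x) = ∑_{m=0}^{s} a_m x^{2m}` with `a_s > 0` and `f ≥ 0`. [cite: ButtaMarchioro2016, §2 (hypotheses on U, V)] -/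
def IsEvenPolyOfDegree (f : ℝ → ℝ) (s : ℕ) : Prop :=
  ∃ a : ℕ → ℝ, 0 < a s ∧ (∀ x : ℝ, f x = ∑ m ∈ Finset.range (s + 1), a m * x ^ (2 * m)) ∧
    ∀ x : ℝ, 0 ≤ f x

/-- BM's superstability estimate (2.3) for a state `ω` (a Borel probability measure on `𝒳`), `d = 1`:
there is `C_ω > 0` such that for all `λ > 0` small enough, `ω(e^{λ W_{μ,k}}) ≤ e^{C_ω (2k+1)}` for
all `μ ∈ ℤ`, `k ∈ ℕ` (expectation as a lower Lebesgue integral, so that divergence is not hidden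
by a junk value). [cite: ButtaMarchioro2016, §2 eq. (2.3)] -/
def HasSuperstabilityEstimate (ω : Measure ChainConfig) : Prop :=
  IsProbabilityMeasure ω ∧ ∃ C lam₀ : ℝ, 0 < C ∧ 0 < lam₀ ∧ ∀ lam : ℝ, 0 < lam → lam ≤ lam₀ →
    ∀ (μ : ℤ) (k : ℕ), ∫⁻ σ, ENNReal.ofReal (Real.exp (lam * P.bmLocalEnergy μ k σ)) ∂ω ≤
      ENNReal.ofReal (Real.exp (C * (2 * (k : ℝ) + 1)))

/-! ### Named facts (Buttà–Marchioro 2016, §2), chain instances -/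

/-- **Buttà–Marchioro 2016, Theorem 2.1, for `d = 1`, `ν = 1`.** Let `U` and `V` be even
non-negative polynomials of degree `2σ₁`, `2σ₂` (`σ₁, σ₂ ≥ 1`), `σ = max{σ₁, σ₂}`,
`η = (σ-1)/σ` (so `ηd = η < 2` automatically). Then there is a one-parameter group of
transformations `Φ_t : 𝒳₀ → 𝒳₀`, `t ∈ ℝ`, such that `t ↦ Φ_t(x)` is the unique global solution of
(2.1) with `Φ_0(x) = x` (uniqueness read among solutions with values in `𝒳₀`, see the module
docstring), and for any `γ ∈ (η, 2)` and `β > 0` there is `C_{γ,β} > 0` with, for all `t > 0`,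
`Q(Φ_t(x)) ≤ C_{γ,β} Q(x) [1 + t^{2/(2-γ)} (1 + t^β) Q(x)^{γ/(2-γ)}]` (2.7). Statement only;
grounds `Summit.AtomisticToContinuum.FouriersLaw.Theses.CurrentTiltQuench.SymmetricSetup`
(dynamics half) and its sibling set-up items. [cite: ButtaMarchioro2016, §2 Thm 2.1] -/
def ButtaMarchioro2016_thm21_chain : Prop :=
  ∀ (P : OscillatorChain) (s₁ s₂ : ℕ), 1 ≤ s₁ → 1 ≤ s₂ →
    IsEvenPolyOfDegree P.U s₁ → IsEvenPolyOfDegree P.V s₂ →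
    ∃ Φ : ℝ → ChainConfig → ChainConfig,
      (∀ t : ℝ, MapsTo (Φ t) P.bmGood P.bmGood) ∧
      (∀ σ ∈ P.bmGood, Φ 0 σ = σ) ∧
      (∀ t s : ℝ, ∀ σ ∈ P.bmGood, Φ (t + s) σ = Φ t (Φ s σ)) ∧
      (∀ σ ∈ P.bmGood, P.IsSolution fun t => Φ t σ) ∧
      (∀ σ ∈ P.bmGood, ∀ γ : ℝ → ChainConfig, γ 0 = σ → P.IsSolution γ →
        (∀ t : ℝ, γ t ∈ P.bmGood) → ∀ t : ℝ, γ t = Φ t σ) ∧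
      ∀ γ' : ℝ, (((max s₁ s₂ : ℕ) : ℝ) - 1) / ((max s₁ s₂ : ℕ) : ℝ) < γ' → γ' < 2 →
        ∀ β' : ℝ, 0 < β' → ∃ C : ℝ, 0 < C ∧ ∀ t : ℝ, 0 < t → ∀ σ ∈ P.bmGood,
          P.bmGrowth (Φ t σ) ≤ C * P.bmGrowth σ *
            (1 + t ^ (2 / (2 - γ')) * (1 + t ^ β') * P.bmGrowth σ ^ (γ' / (2 - γ')))

/-- **Buttà–Marchioro 2016, eq. (2.6) (after Buttà–Caglioti–Di Ruzza–Marchioro 2007, Appendix),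
for `d = 1`.** If the state `ω` satisfies the superstability estimate (2.3), then for any `λ > 0`
small enough `lim_{N → ∞} e^{λN} ω(Q > N) = 0`, "which in particular yields `ω(𝒳₀) = 1`". Here
`{Q > N}` is written junk-free as "some normalised local energy exceeds `N`", and full measure as
`ω(𝒳₀ᶜ) = 0`. Statement only. [cite: ButtaMarchioro2016, §2 eq. (2.6)] -/
def ButtaMarchioro2016_eq26_chain : Prop :=
  ∀ (P : OscillatorChain) (s₁ s₂ : ℕ), 1 ≤ s₁ → 1 ≤ s₂ →
    IsEvenPolyOfDegree P.U s₁ → IsEvenPolyOfDegree P.V s₂ →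
    ∀ ω : Measure ChainConfig, P.HasSuperstabilityEstimate ω →
      (∃ lam₁ : ℝ, 0 < lam₁ ∧ ∀ lam : ℝ, 0 < lam → lam < lam₁ →
        Tendsto (fun N : ℕ => Real.exp (lam * N) *
          (ω {σ | ∃ r ∈ P.bmGrowthSet σ, (N : ℝ) < r}).toReal) atTop (𝓝 0)) ∧
      ω (P.bmGood)ᶜ = 0

/-! ### API -/

/-- Packaging of Thm 2.1 as an `InfiniteChainDynamics` with carrier `𝒳₀ = bmGood`: the flow is
BM's group `Φ_t`, whose uniqueness clause is literally the structure's `unique` field; the group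
law and the growth bound (2.7) are carried along. [cite: ButtaMarchioro2016, §2 Thm 2.1] -/
theorem ButtaMarchioro2016_thm21_chain.exists_dynamics (h : ButtaMarchioro2016_thm21_chain)
    (P : OscillatorChain) {s₁ s₂ : ℕ} (h₁ : 1 ≤ s₁) (h₂ : 1 ≤ s₂)
    (hU : IsEvenPolyOfDegree P.U s₁) (hV : IsEvenPolyOfDegree P.V s₂) :
    ∃ D : InfiniteChainDynamics P, D.carrier = P.bmGood ∧
      (∀ t s : ℝ, ∀ σ ∈ P.bmGood, D.flow (t + s) σ = D.flow t (D.flow s σ)) ∧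
      ∀ γ' : ℝ, (((max s₁ s₂ : ℕ) : ℝ) - 1) / ((max s₁ s₂ : ℕ) : ℝ) < γ' → γ' < 2 →
        ∀ β' : ℝ, 0 < β' → ∃ C : ℝ, 0 < C ∧ ∀ t : ℝ, 0 < t → ∀ σ ∈ P.bmGood,
          P.bmGrowth (D.flow t σ) ≤ C * P.bmGrowth σ *
            (1 + t ^ (2 / (2 - γ')) * (1 + t ^ β') * P.bmGrowth σ ^ (γ' / (2 - γ'))) := by
  obtain ⟨Φ, hmaps, h0, hgrp, hsol, huniq, hbd⟩ := h P s₁ s₂ h₁ h₂ hU hV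
  refine ⟨⟨P.bmGood, Φ, hmaps, h0, hsol, ?_⟩, rfl, hgrp, hbd⟩
  intro γ hγ hsolγ t
  exact huniq (γ 0) (hγ 0) γ rfl hsolγ hγ t

/-- The pinning `U(q) = ω₂ q²/2 + lam q⁴/4` of the tree's `pinnedChain` is an even non-negative
polynomial of degree `4 = 2·2` when `ω₂ ≥ 0`, `lam > 0` (`σ₁ = 2`). [folklore] -/
theorem pinnedChain_isEvenPolyOfDegree_U {ω₂ lam : ℝ} (β γ : ℝ) (hω : 0 ≤ ω₂) (hl : 0 < lam) :
    IsEvenPolyOfDegree (pinnedChain ω₂ lam β γ).U 2 := by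
  refine ⟨fun m => if m = 1 then ω₂ / 2 else if m = 2 then lam / 4 else 0, ?_, ?_, ?_⟩
  · simp [hl]
  · intro x
    show ω₂ * x ^ 2 / 2 + lam * x ^ 4 / 4 = _
    simp [Finset.sum_range_succ]
    ring
  · intro x
    show 0 ≤ ω₂ * x ^ 2 / 2 + lam * x ^ 4 / 4
    positivity

/-- The coupling `V(r) = r²/2 + β r⁴/4` of the tree's `pinnedChain` is an even non-negative
polynomial of degree `4 = 2·2` when `β > 0` (`σ₂ = 2`; so `σ₁ = 2 < 2σ₂ - 1 = 3`, the case of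
BM 2016 not covered by LLL 1977 Thm 1 / BCDM 2007). [folklore] -/
theorem pinnedChain_isEvenPolyOfDegree_V (ω₂ lam : ℝ) {β : ℝ} (γ : ℝ) (hβ : 0 < β) :
    IsEvenPolyOfDegree (pinnedChain ω₂ lam β γ).V 2 := by
  refine ⟨fun m => if m = 1 then 1 / 2 else if m = 2 then β / 4 else 0, ?_, ?_, ?_⟩
  · simp [hβ]
  · intro x
    show x ^ 2 / 2 + β * x ^ 4 / 4 = _
    simp [Finset.sum_range_succ]
    ring
  · intro x
    show 0 ≤ x ^ 2 / 2 + β * x ^ 4 / 4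
    positivity

/-- For the tree's pinned anharmonic chain (`ω₂ ≥ 0`, `lam > 0`, `β > 0`), Thm 2.1 yields an
infinite-volume dynamics with carrier `𝒳₀` (group law included). [cite: ButtaMarchioro2016, §2 Thm 2.1] -/
theorem ButtaMarchioro2016_thm21_chain.exists_dynamics_pinnedChain
    (h : ButtaMarchioro2016_thm21_chain) {ω₂ lam β : ℝ} (γ : ℝ)
    (hω : 0 ≤ ω₂) (hl : 0 < lam) (hβ : 0 < β) :
    ∃ D : InfiniteChainDynamics (pinnedChain ω₂ lam β γ),
      D.carrier = (pinnedChain ω₂ lam β γ).bmGood ∧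
      ∀ t s : ℝ, ∀ σ ∈ (pinnedChain ω₂ lam β γ).bmGood,
        D.flow (t + s) σ = D.flow t (D.flow s σ) := by
  obtain ⟨D, hD, hgrp, -⟩ := h.exists_dynamics (pinnedChain ω₂ lam β γ) (s₁ := 2) (s₂ := 2)
    (by norm_num) (by norm_num) (pinnedChain_isEvenPolyOfDegree_U β γ hω hl)
    (pinnedChain_isEvenPolyOfDegree_V ω₂ lam γ hβ)
  exact ⟨D, hD, hgrp⟩


/-! ### Proof of (2.6): exponential tail of `Q` and full measure of `𝒳₀`

The argument is the standard one referred to by BM ("see, e.g., [BCDM]" = Buttà–Caglioti–Di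
Ruzza–Marchioro, J. Stat. Phys. 127 (2007), Appendix): the exponential Chebyshev inequality
applied to (2.3) gives `ω(W_{μ,k} > N(2k+1)) ≤ e^{-(λ₀N - C_ω)(2k+1)}`, and a union bound over
`μ ∈ ℤ`, `k > log(e + |μ|)` (where `e^{-2k} < (e+|μ|)^{-2}` is summable in `μ`) gives
`ω(Q > N) ≤ K e^{-(λ₀ N - C_ω)}`; hence `e^{λN} ω(Q > N) → 0` for `λ < λ₀` and
`ω(𝒳₀ᶜ) ≤ ω(Q > N) → 0`. The polynomial hypotheses on `U`, `V` enter only through the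
measurability of `W_{μ,k}`. -/

/-- An even polynomial (in the sense of `IsEvenPolyOfDegree`) is continuous. [folklore] -/
theorem IsEvenPolyOfDegree.continuous {f : ℝ → ℝ} {s : ℕ} (h : IsEvenPolyOfDegree f s) :
    Continuous f := by
  obtain ⟨a, -, hf, -⟩ := h
  rw [show f = fun x => ∑ m ∈ Finset.range (s + 1), a m * x ^ (2 * m) from funext hf]
  fun_prop

/-- `W_{μ,k}` is a measurable function of the configuration when `U`, `V` are measurable. [folklore] -/
theorem measurable_bmLocalEnergy (hU : Measurable P.U) (hV : Measurable P.V) (μ : ℤ) (k : ℕ) :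
    Measurable (P.bmLocalEnergy μ k) := by
  have hq : ∀ i : ℤ, Measurable fun σ : ChainConfig => (σ i).1 := fun i =>
    measurable_fst.comp (measurable_pi_apply i)
  have hp : ∀ i : ℤ, Measurable fun σ : ChainConfig => (σ i).2 := fun i =>
    measurable_snd.comp (measurable_pi_apply i)
  unfold bmLocalEnergy
  refine (Finset.measurable_sum _ fun i _ => ?_).add
    (Finset.measurable_sum _ fun i _ => Finset.measurable_sum _ fun j _ => ?_)
  · exact ((((hp i).pow_const 2).div_const 2).add (hU.comp (hq i))).add_const 1
  · by_cases h : |j - i| = 1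
    · simp only [if_pos h]
      exact hV.comp ((hq i).sub (hq j))
    · simp only [if_neg h]
      exact measurable_const

/-- Exponential Chebyshev step: `ω(W_{μ,k} > N(2k+1)) ≤ e^{-(λN - C)(2k+1)}` whenever
`ω(e^{λ W_{μ,k}}) ≤ e^{C(2k+1)}`. [cite: ButtaMarchioro2016, §2 eq. (2.6)] -/
theorem measure_bmLocalEnergy_gt_le {ω : Measure ChainConfig} {μ : ℤ} {k : ℕ}
    (hW : Measurable (P.bmLocalEnergy μ k)) {lam C : ℝ} (hlam : 0 < lam)
    (hint : ∫⁻ σ, ENNReal.ofReal (Real.exp (lam * P.bmLocalEnergy μ k σ)) ∂ω ≤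
      ENNReal.ofReal (Real.exp (C * (2 * (k : ℝ) + 1)))) (N : ℝ) :
    ω {σ | N < P.bmLocalEnergy μ k σ / (2 * (k : ℝ) + 1)} ≤
      ENNReal.ofReal (Real.exp (-(lam * N - C) * (2 * (k : ℝ) + 1))) := by
  have hT : (0 : ℝ) < 2 * (k : ℝ) + 1 := by positivity
  have hmeas : Measurable fun σ => ENNReal.ofReal
      (Real.exp (lam * (P.bmLocalEnergy μ k σ - N * (2 * (k : ℝ) + 1)))) :=
    ENNReal.measurable_ofReal.comp
      (Real.continuous_exp.measurable.comp ((hW.sub_const _).const_mul _))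
  calc ω {σ | N < P.bmLocalEnergy μ k σ / (2 * (k : ℝ) + 1)}
      ≤ ∫⁻ σ, ENNReal.ofReal
          (Real.exp (lam * (P.bmLocalEnergy μ k σ - N * (2 * (k : ℝ) + 1)))) ∂ω := by
        refine meas_le_lintegral₀ hmeas.aemeasurable fun σ hσ => ?_
        have hσ' : N * (2 * (k : ℝ) + 1) < P.bmLocalEnergy μ k σ := (lt_div_iff₀ hT).1 hσ
        exact ENNReal.one_le_ofReal.2 (Real.one_le_exp (by nlinarith))
    _ = ∫⁻ σ, ENNReal.ofReal (Real.exp (-(lam * N * (2 * (k : ℝ) + 1)))) *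
          ENNReal.ofReal (Real.exp (lam * P.bmLocalEnergy μ k σ)) ∂ω := by
        refine lintegral_congr fun σ => ?_
        rw [← ENNReal.ofReal_mul (Real.exp_nonneg _), ← Real.exp_add]
        ring_nf
    _ = ENNReal.ofReal (Real.exp (-(lam * N * (2 * (k : ℝ) + 1)))) *
          ∫⁻ σ, ENNReal.ofReal (Real.exp (lam * P.bmLocalEnergy μ k σ)) ∂ω :=
        lintegral_const_mul' _ _ ENNReal.ofReal_ne_top
    _ ≤ ENNReal.ofReal (Real.exp (-(lam * N * (2 * (k : ℝ) + 1)))) *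
          ENNReal.ofReal (Real.exp (C * (2 * (k : ℝ) + 1))) := by gcongr
    _ = ENNReal.ofReal (Real.exp (-(lam * N - C) * (2 * (k : ℝ) + 1))) := by
        rw [← ENNReal.ofReal_mul (Real.exp_nonneg _), ← Real.exp_add]
        ring_nf

/-- The elementary inequality behind the union bound: for `k > log(e + |μ|)` and `a ≥ 3/2`,
`e^{-a(2k+1)} ≤ e^{-a} · e^{-k} · |μ + 1/2|^{-2}`. [folklore] -/
theorem exp_neg_mul_le_of_log_lt {a : ℝ} (ha : 3 / 2 ≤ a) {μ : ℤ} {k : ℕ}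
    (hk : Real.log (Real.exp 1 + |(μ : ℝ)|) < k) :
    Real.exp (-a * (2 * (k : ℝ) + 1)) ≤
      Real.exp (-a) * (Real.exp (-1) ^ k * (1 / |(μ : ℝ) + 1 / 2| ^ 2)) := by
  have hpos : 0 < Real.exp 1 + |(μ : ℝ)| := by positivity
  have hk' : Real.exp 1 + |(μ : ℝ)| < Real.exp k := by
    calc Real.exp 1 + |(μ : ℝ)| = Real.exp (Real.log (Real.exp 1 + |(μ : ℝ)|)) :=
          (Real.exp_log hpos).symm
      _ < Real.exp k := Real.exp_lt_exp.2 hk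
  have h1 : |(μ : ℝ) + 1 / 2| ≤ Real.exp k := by
    refine le_trans ?_ hk'.le
    calc |(μ : ℝ) + 1 / 2| ≤ |(μ : ℝ)| + |(1 / 2 : ℝ)| := abs_add_le _ _
      _ ≤ Real.exp 1 + |(μ : ℝ)| := by
          rw [abs_of_pos (by norm_num : (0 : ℝ) < 1 / 2)]
          linarith [Real.add_one_le_exp 1]
  have hne : (μ : ℝ) + 1 / 2 ≠ 0 := by
    intro h
    have h2 : ((2 * μ + 1 : ℤ) : ℝ) = 0 := by push_cast; linarith
    have h3 : (2 * μ + 1 : ℤ) = 0 := by exact_mod_cast h2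
    omega
  have habs : 0 < |(μ : ℝ) + 1 / 2| := abs_pos.2 hne
  have h2 : |(μ : ℝ) + 1 / 2| ^ 2 ≤ Real.exp (2 * (k : ℝ)) := by
    calc |(μ : ℝ) + 1 / 2| ^ 2 ≤ Real.exp k ^ 2 := pow_le_pow_left₀ (abs_nonneg _) h1 2
      _ = Real.exp (2 * (k : ℝ)) := by rw [← Real.exp_nat_mul]; norm_num
  have hmain : Real.exp (-(2 * a * k)) ≤ Real.exp (-1) ^ k * (1 / |(μ : ℝ) + 1 / 2| ^ 2) := by
    rw [← Real.exp_nat_mul, mul_one_div, le_div_iff₀ (pow_pos habs 2)]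
    calc Real.exp (-(2 * a * k)) * |(μ : ℝ) + 1 / 2| ^ 2
        ≤ Real.exp (-(2 * a * k)) * Real.exp (2 * (k : ℝ)) := by gcongr
      _ = Real.exp (-((2 * a - 2) * k)) := by rw [← Real.exp_add]; ring_nf
      _ ≤ Real.exp ((k : ℝ) * (-1)) := by
          refine Real.exp_le_exp.2 ?_
          have hk0 : (0 : ℝ) ≤ k := Nat.cast_nonneg k
          nlinarith
  calc Real.exp (-a * (2 * (k : ℝ) + 1)) = Real.exp (-a) * Real.exp (-(2 * a * k)) := by
        rw [← Real.exp_add]; ring_nf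
    _ ≤ Real.exp (-a) * (Real.exp (-1) ^ k * (1 / |(μ : ℝ) + 1 / 2| ^ 2)) := by gcongr

/-- The union bound: under (2.3) at a fixed `λ₀ > 0`, there is a finite constant `K` with
`ω(Q > N) ≤ e^{-(λ₀N - C)} K` as soon as `λ₀ N - C ≥ 3/2`. [cite: ButtaMarchioro2016, §2 eq. (2.6)] -/
theorem measure_bmGrowthSet_gt_le (hU : Measurable P.U) (hV : Measurable P.V)
    {ω : Measure ChainConfig} {C lam₀ : ℝ} (hlam₀ : 0 < lam₀)
    (hss : ∀ (μ : ℤ) (k : ℕ),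
      ∫⁻ σ, ENNReal.ofReal (Real.exp (lam₀ * P.bmLocalEnergy μ k σ)) ∂ω ≤
        ENNReal.ofReal (Real.exp (C * (2 * (k : ℝ) + 1)))) :
    ∃ K : ℝ≥0∞, K ≠ ∞ ∧ ∀ N : ℝ, 3 / 2 ≤ lam₀ * N - C →
      ω {σ | ∃ r ∈ P.bmGrowthSet σ, N < r} ≤
        ENNReal.ofReal (Real.exp (-(lam₀ * N - C))) * K := by
  set ρ : ℝ≥0∞ := ENNReal.ofReal (Real.exp (-1)) with hρ
  set c : ℤ → ℝ≥0∞ := fun μ => ENNReal.ofReal (1 / |(μ : ℝ) + 1 / 2| ^ 2) with hc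
  refine ⟨(∑' k : ℕ, ρ ^ k) * ∑' μ : ℤ, c μ, ENNReal.mul_ne_top ?_ ?_, fun N hN => ?_⟩
  · rw [ENNReal.tsum_geometric, hρ]
    refine ENNReal.inv_ne_top.2 (tsub_pos_iff_lt.2 ?_).ne'
    exact ENNReal.ofReal_lt_one.2 (Real.exp_lt_one_iff.2 (by norm_num))
  · have hs : Summable fun μ : ℤ => 1 / |(μ : ℝ) + 1 / 2| ^ 2 := by
      have := (Real.summable_one_div_int_add_rpow (1 / 2) 2).2 one_lt_two
      simpa only [Real.rpow_two] using this
    rw [hc, ← ENNReal.ofReal_tsum_of_nonneg (fun μ => by positivity) hs]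
    exact ENNReal.ofReal_ne_top
  · -- the events, one per box `Λ_{μ,k}`
    set A : ℤ → ℕ → Set ChainConfig := fun μ k =>
      {σ | Real.log (Real.exp 1 + |(μ : ℝ)|) < k ∧
        N < P.bmLocalEnergy μ k σ / (2 * (k : ℝ) + 1)} with hA
    have hcover : {σ | ∃ r ∈ P.bmGrowthSet σ, N < r} ⊆ ⋃ μ : ℤ, ⋃ k : ℕ, A μ k := by
      rintro σ ⟨r, ⟨μ, k, hk, rfl⟩, hr⟩
      exact Set.mem_iUnion.2 ⟨μ, Set.mem_iUnion.2 ⟨k, hk, hr⟩⟩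
    have hterm : ∀ (μ : ℤ) (k : ℕ),
        ω (A μ k) ≤ ENNReal.ofReal (Real.exp (-(lam₀ * N - C))) * (ρ ^ k * c μ) := by
      intro μ k
      by_cases hk : Real.log (Real.exp 1 + |(μ : ℝ)|) < k
      · calc ω (A μ k) ≤ ω {σ | N < P.bmLocalEnergy μ k σ / (2 * (k : ℝ) + 1)} :=
              measure_mono fun σ hσ => hσ.2
          _ ≤ ENNReal.ofReal (Real.exp (-(lam₀ * N - C) * (2 * (k : ℝ) + 1))) :=
              P.measure_bmLocalEnergy_gt_le (P.measurable_bmLocalEnergy hU hV μ k) hlam₀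
                (hss μ k) N
          _ ≤ ENNReal.ofReal (Real.exp (-(lam₀ * N - C)) *
                (Real.exp (-1) ^ k * (1 / |(μ : ℝ) + 1 / 2| ^ 2))) :=
              ENNReal.ofReal_le_ofReal (exp_neg_mul_le_of_log_lt hN hk)
          _ = ENNReal.ofReal (Real.exp (-(lam₀ * N - C))) * (ρ ^ k * c μ) := by
              rw [ENNReal.ofReal_mul (Real.exp_nonneg _),
                ENNReal.ofReal_mul (pow_nonneg (Real.exp_nonneg _) _),
                ENNReal.ofReal_pow (Real.exp_nonneg _)]
      · have hempty : A μ k = ∅ := by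
          ext σ
          simp only [hA, Set.mem_setOf_eq, Set.mem_empty_iff_false, iff_false, not_and]
          exact fun h => absurd h hk
        rw [hempty, measure_empty]
        exact zero_le
    calc ω {σ | ∃ r ∈ P.bmGrowthSet σ, N < r}
        ≤ ω (⋃ μ : ℤ, ⋃ k : ℕ, A μ k) := measure_mono hcover
      _ ≤ ∑' μ : ℤ, ω (⋃ k : ℕ, A μ k) := measure_iUnion_le _
      _ ≤ ∑' μ : ℤ, ∑' k : ℕ, ω (A μ k) :=
          ENNReal.tsum_le_tsum fun μ => measure_iUnion_le _
      _ ≤ ∑' μ : ℤ, ∑' k : ℕ, ENNReal.ofReal (Real.exp (-(lam₀ * N - C))) * (ρ ^ k * c μ) :=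
          ENNReal.tsum_le_tsum fun μ => ENNReal.tsum_le_tsum fun k => hterm μ k
      _ = ∑' μ : ℤ, ENNReal.ofReal (Real.exp (-(lam₀ * N - C))) * ((∑' k : ℕ, ρ ^ k) * c μ) := by
          refine tsum_congr fun μ => ?_
          rw [ENNReal.tsum_mul_left, ENNReal.tsum_mul_right]
      _ = ENNReal.ofReal (Real.exp (-(lam₀ * N - C))) * ((∑' k : ℕ, ρ ^ k) * ∑' μ : ℤ, c μ) := by
          rw [ENNReal.tsum_mul_left, ENNReal.tsum_mul_left]

/-- **Buttà–Marchioro 2016, eq. (2.6), `d = 1` — proved.** Under the superstability estimate (2.3)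
the growth functional `Q` has an exponential tail, `e^{λN} ω(Q > N) → 0` for all `0 < λ < λ₁`
(here `λ₁ = λ₀`, the range of validity of (2.3)), and `ω(𝒳₀ᶜ) = 0`. Proof: exponential Chebyshev
inequality plus a union bound over the boxes `Λ_{μ,k}`, `k > log(e + |μ|)`, as in
Buttà–Caglioti–Di Ruzza–Marchioro 2007 (Appendix), to which BM refer. [cite: ButtaMarchioro2016, §2 eq. (2.6)] -/
theorem ButtaMarchioro2016_eq26_chain_holds : ButtaMarchioro2016_eq26_chain := by
  intro P s₁ s₂ _ _ hU hV ω hω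
  obtain ⟨hprob, C, lam₀, -, hlam₀, hss⟩ := hω
  obtain ⟨K, hK, hbound⟩ := P.measure_bmGrowthSet_gt_le hU.continuous.measurable
    hV.continuous.measurable hlam₀ (hss lam₀ hlam₀ le_rfl)
  -- eventually `λ₀ N - C ≥ 3/2`
  have hev : ∀ᶠ N : ℕ in atTop, 3 / 2 ≤ lam₀ * N - C := by
    filter_upwards [tendsto_natCast_atTop_atTop.eventually_ge_atTop ((C + 3 / 2) / lam₀)]
      with N hN
    rw [div_le_iff₀ hlam₀] at hN
    linarith
  -- the decay `e^{-(λ₀ N - C)} → 0` along the naturals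
  have hdecay : ∀ {lam : ℝ}, 0 < lam →
      Tendsto (fun N : ℕ => Real.exp (-(lam * N - C))) atTop (𝓝 0) := by
    intro lam hlam
    have h := (tendsto_pow_atTop_nhds_zero_of_lt_one (Real.exp_nonneg (-lam))
      (Real.exp_lt_one_iff.2 (neg_lt_zero.2 hlam))).const_mul (Real.exp C)
    rw [mul_zero] at h
    refine h.congr fun N => ?_
    rw [← Real.exp_nat_mul, ← Real.exp_add]
    ring_nf
  refine ⟨⟨lam₀, hlam₀, fun lam hlam hlt => ?_⟩, ?_⟩
  · -- exponential tail: squeeze between `0` and `K e^{C} e^{-(λ₀ - λ) N}`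
    have hlim : Tendsto (fun N : ℕ => K.toReal * Real.exp (-((lam₀ - lam) * N - C))) atTop
        (𝓝 0) := by
      simpa using (hdecay (sub_pos.2 hlt)).const_mul K.toReal
    refine squeeze_zero' (Eventually.of_forall fun N => by positivity) ?_ hlim
    filter_upwards [hev] with N hN
    have hb := hbound N hN
    have htoReal : (ω {σ | ∃ r ∈ P.bmGrowthSet σ, (N : ℝ) < r}).toReal ≤
        Real.exp (-(lam₀ * N - C)) * K.toReal := by
      calc (ω {σ | ∃ r ∈ P.bmGrowthSet σ, (N : ℝ) < r}).toReal
          ≤ (ENNReal.ofReal (Real.exp (-(lam₀ * N - C))) * K).toReal :=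
            ENNReal.toReal_mono (ENNReal.mul_ne_top ENNReal.ofReal_ne_top hK) hb
        _ = Real.exp (-(lam₀ * N - C)) * K.toReal := by
            rw [ENNReal.toReal_mul, ENNReal.toReal_ofReal (Real.exp_nonneg _)]
    calc Real.exp (lam * N) * (ω {σ | ∃ r ∈ P.bmGrowthSet σ, (N : ℝ) < r}).toReal
        ≤ Real.exp (lam * N) * (Real.exp (-(lam₀ * N - C)) * K.toReal) := by gcongr
      _ = K.toReal * Real.exp (-((lam₀ - lam) * N - C)) := by
          have : Real.exp (lam * N) * Real.exp (-(lam₀ * N - C)) =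
              Real.exp (-((lam₀ - lam) * N - C)) := by
            rw [← Real.exp_add]; ring_nf
          rw [← mul_assoc, this, mul_comm]
  · -- full measure of `𝒳₀`: `𝒳₀ᶜ ⊆ {Q > N}` for every `N`
    have hsub : ∀ N : ℕ, (P.bmGood)ᶜ ⊆ {σ | ∃ r ∈ P.bmGrowthSet σ, (N : ℝ) < r} := by
      intro N σ hσ
      simp only [bmGood, Set.mem_compl_iff, Set.mem_setOf_eq, not_bddAbove_iff] at hσ
      exact hσ N
    have hlim : Tendsto (fun N : ℕ => ENNReal.ofReal (Real.exp (-(lam₀ * N - C))) * K) atTop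
        (𝓝 0) := by
      have h := ENNReal.Tendsto.mul_const (ENNReal.tendsto_ofReal (hdecay hlam₀)) (Or.inr hK)
      simpa using h
    refine le_antisymm (ge_of_tendsto hlim ?_) zero_le
    filter_upwards [hev] with N hN
    exact (measure_mono (hsub N)).trans (hbound N hN)
end OscillatorChain

end Literature.MathematicalPhysics.KineticTheory.HeatConduction
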